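import Summits.AtomisticToContinuum.HydrodynamicLimit.Theorems.AntiMazurCoboundariesCorrectorPressureDecayTangentTightness
import Summits.AtomisticToContinuum.HydrodynamicLimit.Theorems.AntiMazurCoboundariesCorrectorPressureDecayTangentTightnessLaplaceUniqueness

/-!
# Tangent tightness, IV: the uniqueness fact is discharged — tightness modulo hard-core compactness alone
# (line `FirstLemma`, crux stmt-AtomisticToContinuum-14135)

`TangentTightness` (…KiferTangent.lean) was reduced in …TangentTightness.lean (`stub_tangentTightnessOfFacts`, p142323) to the
two named facts of `Literature/MathematicalPhysics/KineticTheory/PointProcessVagueCompactness.lean` (p142217). The second one,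
`LaplaceFunctionalDeterminesLaw` (Kallenberg 2002 Lemma 12.1: the Laplace functional on `C_c⁺` determines a finite law on
`PointConfig X`), is now PROVED in the tree by a wave-3 stub-worker of lead a1 as `stub_laplaceFunctionalDeterminesLaw`
(…TangentTightnessLaplaceUniquenessCore.lean p143064 + …TangentTightnessLaplaceUniqueness.lean p143534: Stone–Weierstrass on
`[0,1]^m` for the joint laws of linear statistics, counts of compact sets as monotone limits, and a π-λ argument with the count
cylinders). This file records the DISCHARGE `laplaceFunctionalDeterminesLaw_holds` and the sharper reduction
`stub_tangentTightnessOfCompactness : HardCoreLawsVaguelyCompact → TangentTightness` (registered stub): tightness of tangent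
families now rests on ONE named fact, the vague sequential compactness of hard-core laws (Kallenberg L16.15/T16.16/A2.3(ii)).
-/

noncomputable section

namespace Summit.AtomisticToContinuum.HydrodynamicLimit.Theorems.KiferCompactification

open Literature.MathematicalPhysics.KineticTheory.PointProcess (HardCoreLawsVaguelyCompact LaplaceFunctionalDeterminesLaw)

/-- **Kallenberg's Lemma 12.1 is discharged**: the named fact `LaplaceFunctionalDeterminesLaw` of
`Literature/MathematicalPhysics/KineticTheory/PointProcessVagueCompactness.lean` HOLDS, by the tree theorem
`stub_laplaceFunctionalDeterminesLaw` (p143534). -/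
theorem laplaceFunctionalDeterminesLaw_holds : LaplaceFunctionalDeterminesLaw := by
  unfold LaplaceFunctionalDeterminesLaw
  exact stub_laplaceFunctionalDeterminesLaw

/-- **Tightness of tangent families modulo hard-core compactness alone** (registered stub
`stub_tangentTightnessOfCompactness` of line `FirstLemma`): `HardCoreLawsVaguelyCompact → TangentTightness`, from
`stub_tangentTightnessOfFacts` and the discharged uniqueness fact. -/
theorem stub_tangentTightnessOfCompactness : HardCoreLawsVaguelyCompact → TangentTightness :=
  fun h => stub_tangentTightnessOfFacts h laplaceFunctionalDeterminesLaw_holds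

end Summit.AtomisticToContinuum.HydrodynamicLimit.Theorems.KiferCompactification

end
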